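import Literature.MathematicalPhysics.KineticTheory.HardSphereEuler
import Literature.Analysis.FluidPDE.LocalForecastCorrector
import Literature.Analysis.FluidPDE.HardSphereDynamicsProofs
import Literature.Analysis.FluidPDE.HardSphereFreeStretch
import HarnessLib

/-!
# Influence chains: the deterministic core of collar locality

Crux `Summit.AtomisticToContinuum.HydrodynamicLimit.Theses.AntiMazurCoboundaries.KineticWindowGronwall`
(stmt-AtomisticToContinuum-9282, `= FluxGibbsianityLdDrude.KineticWindowGronwall` by `rfl`), skeleton line
`dlr-block-transfer`, registered stub `stub_collarLocality : CollarInfluenceLocality` — ONE-WINDOW INFLUENCE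
LOCALITY ACROSS A MACROSCOPIC COLLAR: under the homogeneous canonical Gibbs law the number of particles `i` whose
true state `Φ_t(z)_i` differs, within one kinetic window, from the LOCAL FORECAST `localClusterState Ψ r t z i`
(isolated evolution of the particles initially within minimal-image distance `r` of `x_i`) has exponential
moments `≤ e^{δ(N+1)}` at every rate. That statement is a large-deviation estimate whose dynamical inputs are
not in the tree; this file lands its DETERMINISTIC CORE, the domain-of-dependence property of hard-sphere
dynamics on which every such estimate rests (registered helper stub `stub_influenceChain : InfluenceChainLemma`;
the null-set preliminary and the almost-sure form are the companion file
`AntiMazurCoboundariesKineticWindowGronwallCollarLocalityAE`):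

* `agree_of_closed` — **agreement on a contact-closed set.** Two hard-sphere trajectories `γ` (`N` spheres)
  and `γ'` (`k` spheres, embedded in the first by an injection `e` of labels; same geometry, same diameter)
  that agree at time `0` on a set `A` of labels agree on `A` throughout `[0, T]`, provided no particle of `A`
  touches during `[0, T]`, in `γ`, a particle outside `e '' A`, nor, in `γ'`, a particle outside `A`
  (localised forward uniqueness: the infimum of the disagreement times of `A` is not a disagreement time —
  positions are continuous, left limits of the particles of `A` agree, a collision of `γ` involving `A` is a
  collision of the same pair with the same incoming data in `γ'`, every other particle of `A` keeps its left
  limit — and agreement propagates to the right by free flight; cf. `IsHardSphereTrajectory.unique_holds`);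
* `exists_chain_of_ne` — **influence chains**: if `γ'` starts from the restriction of `γ 0` and disagrees with
  `γ` on the label `a` at some time of `[0, T]`, then `a` is joined through links of the window (contacts in
  `γ` between embedded particles, or contacts in `γ'`) to a label whose particle touches in `γ`, within the
  window, a particle outside the range of `e` (the complement of the set of such labels is contact-closed);
* `chain_of_ne_clusterStateIn`, `chain_of_ne_localClusterState` — the same for the isolated evolution
  `clusterStateIn` / the local forecast `localClusterState` of `Literature.Analysis.FluidPDE.LocalForecastCorrector`
  along hard-sphere FLOWS (good data), in any geometry with continuous translations; `stub_influenceChain` is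
  the flat-torus instance over the objects of `CollarInfluenceLocality` (`𝕋³`, diameter `hsDiameter σ N`,
  minimal-image distance `Torus.euclidDist`).

Consequence for the stub (not formalised here): a corrupted forecast at collar `r` within the window
`h = τ(N+1)^{-1/3}` forces a chain `i = p₀, p₁, …, pₙ, j` of window contacts with `dist(x_i(0), x_j(0)) > r`,
hence `r < (n+1)(ε + 2hV)` with `V` the largest speed met along the chain in either dynamics (each link is a
contact, `Torus.euclidDist = ε`, displaced by at most `hV` at each end): few links force a fast carrier, slow
carriers force `≳ r(N+1)^{1/3}/σ` links. The probabilistic half (pricing long chains and fast carriers under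
the invariant Gibbs law, jointly over the particles) is the open content of `stub_collarLocality`.

References: R. K. Alexander, *The infinite hard sphere system* (1975), Ch. 2 (domain of dependence / finite
clusters of the hard-sphere dynamics); I. Gallagher, L. Saint-Raymond, B. Texier, *From Newton to Boltzmann*
(2013), §4.1 (well-posedness away from the pathological set); C. Cercignani, R. Illner, M. Pulvirenti,
*The Mathematical Theory of Dilute Gases* (1994), App. 4.A.
-/
noncomputable section

namespace Summit.AtomisticToContinuum.HydrodynamicLimit.Theorems.KineticWindowGronwallCollarLocality

open MeasureTheory Set Filter Topology
open scoped ENNReal BigOperators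
open Literature.MathematicalPhysics.KineticTheory (T3 V3 hsDiameter localGibbsLaw)
open Literature.Analysis.FluidPDE

section Deterministic

variable {d : Type*} [Fintype d] {X : Type*} [TopologicalSpace X] [T2Space X]
  {G : Geometry d X} {ε : ℝ} {N k : ℕ}

/-- The configurations in which particles `p` and `q` are in contact (in either order of the pair: for an
abstract geometry the separation vector need not be antisymmetric). -/
def touching (G : Geometry d X) (ε : ℝ) (p q : Fin N) : Set (Config N d X) :=
  contactSet G N ε p q ∪ contactSet G N ε q p

omit [TopologicalSpace X] [T2Space X] in
/-- Membership in `touching`. -/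
theorem mem_touching {z : Config N d X} {p q : Fin N} :
    z ∈ touching G ε p q ↔ z ∈ contactSet G N ε p q ∨ z ∈ contactSet G N ε q p :=
  Iff.rfl

/-- **Agreement on a contact-closed set of particles.** Two hard-sphere trajectories `γ` (`N` particles) and
`γ'` (`k` particles, embedded in the first by the injection `e`) that agree at time `0` on a set `A` of labels
agree on `A` throughout `[0, T]`, provided that during `[0, T]` no particle of `A` touches, in `γ`, a particle
outside `e '' A`, and no particle of `A` touches, in `γ'`, a particle outside `A`. -/
theorem agree_of_closed (hG : ∀ x : X, Continuous (G.translate x))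
    {γ : ℝ → Config N d X} {γ' : ℝ → Config k d X}
    (hγ : IsHardSphereTrajectory G ε N γ) (hγ' : IsHardSphereTrajectory G ε k γ')
    {e : Fin k → Fin N} (he : Function.Injective e) {A : Set (Fin k)}
    (h0 : ∀ a ∈ A, γ 0 (e a) = γ' 0 a) {T : ℝ}
    (hA : ∀ t ∈ Icc 0 T, ∀ a ∈ A, ∀ j, γ t ∈ touching G ε (e a) j → j ∈ e '' A)
    (hA' : ∀ t ∈ Icc 0 T, ∀ a ∈ A, ∀ b, γ' t ∈ touching G ε a b → b ∈ A) :
    ∀ t ∈ Icc 0 T, ∀ a ∈ A, γ t (e a) = γ' t a := by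
  classical
  by_contra hcon
  push Not at hcon
  obtain ⟨t₁, ht₁, a₁, ha₁, hne₁⟩ := hcon
  set S : Set ℝ := {t | t ∈ Icc 0 T ∧ ∃ a ∈ A, γ t (e a) ≠ γ' t a} with hS
  have hSne : S.Nonempty := ⟨t₁, ht₁, a₁, ha₁, hne₁⟩
  have hSbdd : BddBelow S := ⟨0, fun t ht => ht.1.1⟩
  set τ := sInf S with hτ
  have hτ0 : 0 ≤ τ := le_csInf hSne fun t ht => ht.1.1
  have hτT : τ ≤ T := (csInf_le hSbdd ⟨ht₁, a₁, ha₁, hne₁⟩).trans ht₁.2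
  have hτI : τ ∈ Icc 0 T := ⟨hτ0, hτT⟩
  have hagree : ∀ t, 0 ≤ t → t < τ → ∀ a ∈ A, γ t (e a) = γ' t a := by
    intro t h1 h2 a ha
    by_contra hne'
    have htS : t ∈ S := ⟨⟨h1, h2.le.trans hτT⟩, a, ha, hne'⟩
    exact (lt_irrefl t) (h2.trans_le (csInf_le hSbdd htS))
  -- Step A: agreement at `τ`
  have hAτ : ∀ a ∈ A, γ τ (e a) = γ' τ a := by
    rcases hτ0.eq_or_lt with heq | hlt
    · rw [← heq]; exact h0
    intro a ha
    set L := Function.leftLim γ τ with hL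
    set L' := Function.leftLim γ' τ with hL'
    -- left limits of the particles of `A` agree
    have hLL : ∀ b ∈ A, L (e b) = L' b := by
      intro b hb
      have h1 : Tendsto (fun t => γ t (e b)) (𝓝[<] τ) (𝓝 (L (e b))) :=
        ((continuous_apply (e b)).tendsto _).comp (hγ.tendsto_leftLim hG τ)
      have h2 : Tendsto (fun t => γ' t b) (𝓝[<] τ) (𝓝 (L' b)) :=
        ((continuous_apply b).tendsto _).comp (hγ'.tendsto_leftLim hG τ)
      have hev : (fun t => γ t (e b)) =ᶠ[𝓝[<] τ] fun t => γ' t b := by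
        filter_upwards [Ioo_mem_nhdsLT hlt] with t ht
        exact hagree t ht.1.le ht.2 b hb
      exact tendsto_nhds_unique (h1.congr' hev) h2
    -- hence so do their positions at `τ`
    have hpos : ∀ b ∈ A, (γ τ (e b)).1 = (γ' τ b).1 := by
      intro b hb
      rw [← hγ.leftLim_apply_fst hG τ (e b), ← hγ'.leftLim_apply_fst hG τ b]
      exact congrArg Prod.fst (hLL b hb)
    by_cases hcase : ∃ i j : Fin N, i ≠ j ∧ γ τ ∈ contactSet G N ε i j ∧ (i ∈ e '' A ∨ j ∈ e '' A)
    · -- Case 1: a contact of `γ` at `τ` involving a particle of `A`: both partners are in `A`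
      obtain ⟨i, j, hij, hct, hiA⟩ := hcase
      have hboth : i ∈ e '' A ∧ j ∈ e '' A := by
        rcases hiA with ⟨a₁, ha₁A, rfl⟩ | ⟨a₂, ha₂A, rfl⟩
        · exact ⟨⟨a₁, ha₁A, rfl⟩, hA τ hτI a₁ ha₁A j (mem_touching.2 (Or.inl hct))⟩
        · exact ⟨hA τ hτI a₂ ha₂A i (mem_touching.2 (Or.inr hct)), ⟨a₂, ha₂A, rfl⟩⟩
      obtain ⟨⟨a₁, ha₁A, rfl⟩, ⟨a₂, ha₂A, rfl⟩⟩ := hboth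
      have ha₁₂ : a₁ ≠ a₂ := fun h => hij (congrArg e h)
      -- the same pair is in contact in `γ'`
      have hct' : γ' τ ∈ contactSet G k ε a₁ a₂ := by
        refine ⟨hγ'.mem τ, ?_⟩
        rw [← hpos a₁ ha₁A, ← hpos a₂ ha₂A]
        exact hct.2
      have hγτ := (hγ.eq_collidePair_leftLim hij hct).2
      have hγ'τ := (hγ'.eq_collidePair_leftLim ha₁₂ hct').2
      rw [hγτ, hγ'τ]
      by_cases h1 : a = a₁
      · subst h1
        rw [collidePair_apply_left hij, collidePair_apply_left ha₁₂, ← hL, ← hL', hLL a ha,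
          hLL a₂ ha₂A]
      by_cases h2 : a = a₂
      · subst h2
        rw [collidePair_apply_right, collidePair_apply_right, ← hL, ← hL', hLL a₁ ha₁A, hLL a ha]
      rw [collidePair_apply_of_ne (he.ne h1) (he.ne h2), collidePair_apply_of_ne h1 h2, ← hL, ← hL']
      exact hLL a ha
    · -- Case 2: no particle of `A` is involved in a contact at `τ`, in `γ` and hence in `γ'`
      push Not at hcase
      have hval : γ τ (e a) = L (e a) := by
        by_cases hcol : τ ∈ collisionTimes G ε γ
        · obtain ⟨i, j, hij, hct⟩ := hcol
          obtain ⟨hi, hj⟩ := hcase i j hij hct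
          have h1 : e a ≠ i := fun h => hi ⟨a, ha, h⟩
          have h2 : e a ≠ j := fun h => hj ⟨a, ha, h⟩
          rw [(hγ.eq_collidePair_leftLim hij hct).2, collidePair_apply_of_ne h1 h2]
        · rw [← hγ.leftLim_eq_of_not_mem hG hcol]
      have hval' : γ' τ a = L' a := by
        by_cases hcol : τ ∈ collisionTimes G ε γ'
        · obtain ⟨b, b', hbb, hct⟩ := hcol
          -- neither `b` nor `b'` lies in `A`
          have hbA : b ∉ A ∧ b' ∉ A := by
            have key : b ∈ A → b' ∈ A → False := fun hb hb' => by
              have hctγ : γ τ ∈ contactSet G N ε (e b) (e b') := by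
                refine ⟨hγ.mem τ, ?_⟩
                rw [hpos b hb, hpos b' hb']
                exact hct.2
              exact (hcase (e b) (e b') (he.ne hbb) hctγ).1 ⟨b, hb, rfl⟩
            constructor
            · intro hb
              exact key hb (hA' τ hτI b hb b' (Or.inl hct))
            · intro hb'
              exact key (hA' τ hτI b' hb' b (Or.inr hct)) hb'
          have h1 : a ≠ b := fun h => hbA.1 (h ▸ ha)
          have h2 : a ≠ b' := fun h => hbA.2 (h ▸ ha)
          rw [(hγ'.eq_collidePair_leftLim hbb hct).2, collidePair_apply_of_ne h1 h2]
        · rw [← hγ'.leftLim_eq_of_not_mem hG hcol]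
      rw [hval, hval']
      exact hLL a ha
  -- Step B: agreement on a right neighbourhood of `τ`
  obtain ⟨η, hη, hB⟩ : ∃ η > 0, ∀ t, τ < t → t < τ + η → ∀ a ∈ A, γ t (e a) = γ' t a := by
    obtain ⟨u, hu, hfree⟩ := hγ.exists_Ioo_right_free τ
    obtain ⟨u', hu', hfree'⟩ := hγ'.exists_Ioo_right_free τ
    refine ⟨min u u' - τ, by simp [hu, hu'], fun t h1 h2 a ha => ?_⟩
    have htu : t < u := by linarith [min_le_left u u']
    have htu' : t < u' := by linarith [min_le_right u u']
    rw [hγ.free τ t h1.le fun s hs => hfree s ⟨hs.1, hs.2.trans_lt htu⟩,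
      hγ'.free τ t h1.le fun s hs => hfree' s ⟨hs.1, hs.2.trans_lt htu'⟩,
      freeFlight_apply, freeFlight_apply, hAτ a ha]
  -- Step C: `τ + η` is a lower bound of `S`, a contradiction
  have hle : τ + η ≤ τ := by
    refine le_csInf hSne fun t ht => ?_
    by_contra hlt
    push Not at hlt
    have hτt : τ ≤ t := csInf_le hSbdd ht
    obtain ⟨a, ha, hne⟩ := ht.2
    rcases hτt.eq_or_lt with heq | hlt'
    · exact hne (heq ▸ hAτ a ha)
    · exact hne (hB t hlt' hlt a ha)
  linarith

/-- **Influence chains (abstract form).** If the embedded trajectory `γ'` (started from the restriction of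
`γ 0` along `e`) disagrees with `γ` on the label `a` at some time of `[0, T]`, then `a` is joined, through a
chain of links of the window (contacts in `γ` between embedded particles, or contacts in `γ'`), to a label
whose particle touches in `γ`, within the window, a particle OUTSIDE the range of `e`. (Apply it with `T`
equal to the disagreement time to confine all the contacts of the chain before that time.) -/
theorem exists_chain_of_ne (hG : ∀ x : X, Continuous (G.translate x))
    {γ : ℝ → Config N d X} {γ' : ℝ → Config k d X}
    (hγ : IsHardSphereTrajectory G ε N γ) (hγ' : IsHardSphereTrajectory G ε k γ')
    {e : Fin k → Fin N} (he : Function.Injective e) (h0 : ∀ a, γ 0 (e a) = γ' 0 a) {T : ℝ}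
    {a : Fin k} (hne : ∃ t ∈ Icc 0 T, γ t (e a) ≠ γ' t a) :
    ∃ b, Relation.ReflTransGen
        (fun a b : Fin k => ∃ t ∈ Icc 0 T, γ t ∈ touching G ε (e a) (e b) ∨ γ' t ∈ touching G ε a b) a b ∧
      ∃ t ∈ Icc 0 T, ∃ j ∉ Set.range e, γ t ∈ touching G ε (e b) j := by
  by_contra H
  set A : Set (Fin k) :=
    {c | ¬ ∃ b, Relation.ReflTransGen
        (fun a b : Fin k => ∃ t ∈ Icc 0 T, γ t ∈ touching G ε (e a) (e b) ∨ γ' t ∈ touching G ε a b) c b ∧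
      ∃ t ∈ Icc 0 T, ∃ j ∉ Set.range e, γ t ∈ touching G ε (e b) j} with hAdef
  have haA : a ∈ A := H
  have hA : ∀ t ∈ Icc 0 T, ∀ c ∈ A, ∀ j, γ t ∈ touching G ε (e c) j → j ∈ e '' A := by
    intro t ht c hc j hj
    by_cases hjr : j ∈ Set.range e
    · obtain ⟨c', rfl⟩ := hjr
      refine ⟨c', ?_, rfl⟩
      rintro ⟨b, hb, hbE⟩
      exact hc ⟨b, Relation.ReflTransGen.head ⟨t, ht, Or.inl hj⟩ hb, hbE⟩
    · exact (hc ⟨c, Relation.ReflTransGen.refl, t, ht, j, hjr, hj⟩).elim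
  have hA' : ∀ t ∈ Icc 0 T, ∀ c ∈ A, ∀ b, γ' t ∈ touching G ε c b → b ∈ A := by
    rintro t ht c hc b hb ⟨b', hb', hbE⟩
    exact hc ⟨b', Relation.ReflTransGen.head ⟨t, ht, Or.inr hb⟩ hb', hbE⟩
  obtain ⟨t, ht, hne⟩ := hne
  exact hne (agree_of_closed hG hγ hγ' he (fun c _ => h0 c) hA hA' t ht a haA)

/-! ## Along hard-sphere flows: the forecast of a cluster -/

variable [MeasureSpace X]

/-- **Influence chains for an isolated cluster.** Let `z` be a good datum of the flow `Φ` whose restriction to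
a set `S ∋ i` of particles is a good datum of the cluster flow `Ψ S.card`. If on `[0, T]` the true state of
`i` ever differs from its state in the ISOLATED evolution of `S` (`clusterStateIn`), then `i` is joined by a
chain of links of the window (contacts among particles of `S`, in the true or in the isolated dynamics) to a
particle of `S` that touches, in the true dynamics and within the window, a particle outside `S`. -/
theorem chain_of_ne_clusterStateIn (hG : ∀ x : X, Continuous (G.translate x))
    (Φ : HardSphereFlow G ε N) (Ψ : (k : ℕ) → HardSphereFlow G ε k) (S : Finset (Fin N)) (T : ℝ)
    {z : Config N d X} {i : Fin N} (hi : i ∈ S) (hz : z ∈ Φ.good)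
    (hz' : Config.restrictTo S z ∈ (Ψ S.card).good)
    (hne : ∃ t ∈ Icc 0 T, Φ.flow t z i ≠ clusterStateIn Ψ S (clusterIndex S i hi) t z) :
    ∃ b : Fin S.card,
      Relation.ReflTransGen (fun a b : Fin S.card => ∃ t ∈ Icc 0 T,
          Φ.flow t z ∈ touching G ε (S.orderEmbOfFin rfl a) (S.orderEmbOfFin rfl b) ∨
            (Ψ S.card).flow t (Config.restrictTo S z) ∈ touching G ε a b) (clusterIndex S i hi) b ∧
      ∃ t ∈ Icc 0 T, ∃ j ∉ S, Φ.flow t z ∈ touching G ε (S.orderEmbOfFin rfl b) j := by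
  have hne' : ∃ t ∈ Icc 0 T, Φ.flow t z (S.orderEmbOfFin rfl (clusterIndex S i hi)) ≠
      (Ψ S.card).flow t (Config.restrictTo S z) (clusterIndex S i hi) := by
    obtain ⟨t, ht, hne⟩ := hne
    refine ⟨t, ht, ?_⟩
    rwa [orderEmbOfFin_clusterIndex, ← clusterStateIn_of_mem_good Ψ _ t hz']
  have h0 : ∀ a, Φ.flow 0 z (S.orderEmbOfFin rfl a) = (Ψ S.card).flow 0 (Config.restrictTo S z) a := by
    intro a
    rw [Φ.flow_zero z hz, (Ψ S.card).flow_zero _ hz', Config.restrictTo_apply]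
  obtain ⟨b, hb, t, ht, j, hj, hT⟩ := exists_chain_of_ne hG (Φ.isTrajectory z hz)
    ((Ψ S.card).isTrajectory _ hz') (S.orderEmbOfFin rfl).injective h0 hne'
  refine ⟨b, hb, t, ht, j, ?_, hT⟩
  rwa [Finset.range_orderEmbOfFin, Finset.mem_coe] at hj

/-- **Influence chains for the local forecast** (`localClusterState`, range `R`): if on `[0, T]` the true
state of `i` ever differs from its local cluster state, then `i` is joined by a chain of links of the window
(contacts among particles of its range cluster, in the true or in the isolated dynamics) to a cluster particle
that touches, in the true dynamics and within the window, a particle `j` initially BEYOND range `R` of `i`. -/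
theorem chain_of_ne_localClusterState (hG : ∀ x : X, Continuous (G.translate x))
    (Φ : HardSphereFlow G ε N) (Ψ : (k : ℕ) → HardSphereFlow G ε k) (R T : ℝ)
    {z : Config N d X} {i : Fin N} (hz : z ∈ Φ.good)
    (hz' : Config.restrictTo (rangeCluster G R z i) z ∈ (Ψ (rangeCluster G R z i).card).good)
    (hne : ∃ t ∈ Icc 0 T, Φ.flow t z i ≠ localClusterState Ψ R t z i) :
    ∃ b : Fin (rangeCluster G R z i).card,
      Relation.ReflTransGen (fun a b : Fin (rangeCluster G R z i).card => ∃ t ∈ Icc 0 T,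
          Φ.flow t z ∈ touching G ε ((rangeCluster G R z i).orderEmbOfFin rfl a)
              ((rangeCluster G R z i).orderEmbOfFin rfl b) ∨
            (Ψ (rangeCluster G R z i).card).flow t (Config.restrictTo (rangeCluster G R z i) z) ∈
              touching G ε a b)
        (clusterIndex (rangeCluster G R z i) i (self_mem_rangeCluster G R z i)) b ∧
      ∃ t ∈ Icc 0 T, ∃ j : Fin N, j ≠ i ∧ R < ‖G.sepVec (z i).1 (z j).1‖ ∧
        Φ.flow t z ∈ touching G ε ((rangeCluster G R z i).orderEmbOfFin rfl b) j := by
  obtain ⟨b, hb, t, ht, j, hj, hT⟩ :=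
    chain_of_ne_clusterStateIn hG Φ Ψ (rangeCluster G R z i) T (self_mem_rangeCluster G R z i) hz hz' hne
  refine ⟨b, hb, t, ht, j, ?_, ?_, hT⟩
  · exact fun h => hj (mem_rangeCluster.2 (Or.inl h))
  · exact lt_of_not_ge fun h => hj (mem_rangeCluster.2 (Or.inr h))

end Deterministic

/-! ## The registered statement (torus, the objects of `CollarInfluenceLocality`) -/

/-- **INFLUENCE-CHAIN LEMMA** (registered helper stub `stub_influenceChain` of line `dlr-block-transfer`,
crux `KineticWindowGronwall`, stmt-AtomisticToContinuum-9282): the deterministic core of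
`CollarInfluenceLocality`. For the true flow `Φ` of `N + 1` spheres of diameter `hsDiameter σ N` on `𝕋³`,
any family `Ψ` of cluster flows, a datum `z` good for `Φ` whose range-`r` cluster around `i` restricts to a
good datum of its cluster flow: if the forecast of `i` fails on `[0, T]`
(`Φ_t(z)_i ≠ localClusterState Ψ r t z i` for some `t ∈ [0, T]`), then the cluster label of `i` is joined by
a chain of links of the window — each a contact, at some time of `[0, T]`, between two cluster particles in
the true dynamics or in the isolated cluster dynamics — to a cluster particle that is in contact, in the true
dynamics at some time of `[0, T]`, with a particle `j` at initial minimal-image distance `> r` from `x_i(0)`.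
No outside influence, no forecast error: every corrupted forecast is CAUSALLY CONNECTED TO THE COLLAR'S
EXTERIOR within the window. -/
def InfluenceChainLemma : Prop :=
  ∀ (σ r T : ℝ) (N : ℕ) (Φ : HardSphereFlow (Torus.geometry (Fin 3)) (hsDiameter σ N) (N + 1))
    (Ψ : (k : ℕ) → HardSphereFlow (Torus.geometry (Fin 3)) (hsDiameter σ N) k)
    (z : Config (N + 1) (Fin 3) T3) (i : Fin (N + 1)),
    z ∈ Φ.good →
    Config.restrictTo (rangeCluster (Torus.geometry (Fin 3)) r z i) z ∈
      (Ψ (rangeCluster (Torus.geometry (Fin 3)) r z i).card).good →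
    (∃ t ∈ Set.Icc 0 T, Φ.flow t z i ≠ localClusterState Ψ r t z i) →
    ∃ b : Fin (rangeCluster (Torus.geometry (Fin 3)) r z i).card,
      Relation.ReflTransGen (fun a b : Fin (rangeCluster (Torus.geometry (Fin 3)) r z i).card =>
          ∃ t ∈ Set.Icc 0 T,
            Φ.flow t z ∈ touching (Torus.geometry (Fin 3)) (hsDiameter σ N)
                ((rangeCluster (Torus.geometry (Fin 3)) r z i).orderEmbOfFin rfl a)
                ((rangeCluster (Torus.geometry (Fin 3)) r z i).orderEmbOfFin rfl b) ∨
              (Ψ (rangeCluster (Torus.geometry (Fin 3)) r z i).card).flow t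
                  (Config.restrictTo (rangeCluster (Torus.geometry (Fin 3)) r z i) z) ∈
                touching (Torus.geometry (Fin 3)) (hsDiameter σ N) a b)
        (clusterIndex (rangeCluster (Torus.geometry (Fin 3)) r z i) i
          (self_mem_rangeCluster (Torus.geometry (Fin 3)) r z i)) b ∧
      ∃ t ∈ Set.Icc 0 T, ∃ j : Fin (N + 1), j ≠ i ∧ r < Torus.euclidDist (z i).1 (z j).1 ∧
        Φ.flow t z ∈ touching (Torus.geometry (Fin 3)) (hsDiameter σ N)
          ((rangeCluster (Torus.geometry (Fin 3)) r z i).orderEmbOfFin rfl b) j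

/-- **STUB `stub_influenceChain`** (helper stub of line `dlr-block-transfer`, crux `KineticWindowGronwall`,
stmt-AtomisticToContinuum-9282): the influence-chain lemma on `𝕋³`, from `chain_of_ne_localClusterState`
(`Torus.continuous_geometry_translate`; the minimal-image distance is `‖sepVec‖`, `Torus.norm_geometry_sepVec`). -/
theorem stub_influenceChain : InfluenceChainLemma := by
  intro σ r T N Φ Ψ z i hz hz' hne
  obtain ⟨b, hb, t, ht, j, hji, hr, hT⟩ :=
    chain_of_ne_localClusterState Torus.continuous_geometry_translate Φ Ψ r T hz hz' hne
  exact ⟨b, hb, t, ht, j, hji, (Torus.norm_geometry_sepVec (z i).1 (z j).1) ▸ hr, hT⟩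



end Summit.AtomisticToContinuum.HydrodynamicLimit.Theorems.KineticWindowGronwallCollarLocality

end
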